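import Summits.AtomisticToContinuum.Crystallization.Theorems.OverbindingBudgetAffineStableDescent

/-!
# Overbinding budget — affine FIRM descent (lens-4 g104 node «FirmDescent», imports (429)/(430) «StableDescent»)

The strong-move normal form of the second-order descent.  (429) `LocStable δ κ Ls` only forbids energy-lowering moves of amplitude `≤ δ/4`
(infinitesimal stability); its rigidity piece `StableRigidity 1` therefore has to rule out one-homogeneous locally-stable NON-homogeneous
states (general-theory cones, Mooney–Savin) by LJ-specific structure alone.  Here the guard is strengthened to **firm stability**
`FirmStable δ κ Ls`: no REARRANGEMENT supported on the in-window sites of the `Ls·nn`-ball — of ANY amplitude up to `Ls·nn`, keeping the moved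
configuration injective — lowers the energy by more than `κ`.  Finite-amplitude competitors (cavitation, dislocation-loop nucleation, affine
replacement with a transition annulus) are then admissible tests, and the rigidity piece `FirmRigidity t` is KERNEL-WEAKER than
`StableRigidity t` (`firmRigidity_of_stableRigidity`), while the payer `FirmGain` (firm-unstable deep in-window sites pay; same separated-family
argument as `SoftGain`, larger separation) is kernel-stronger than `SoftGain` (`softGain_of_firmGain`).  The generic-guard glue of (430)
(`affMidGapW_of_guard`) gives `CoarseMid` and the record seam/cone with `StableRigidity` ABSENT.

Contents: §1 vocabulary (`FirmStable`, `FirmUnstable`, `firmUnstableCount`, `FirmGuard`) · §2 pieces (`FirmGain`, `FirmRigidity t`) ·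
§3 kernel comparisons (`firmRigidity_of_stableRigidity`, `firmRigidity_anti`, `softGain_of_firmGain`, `guardBadCount_firm_le`) ·
§4 glue `coarseMid_of_firm_pieces (t ≤ 21/20)`, record instance, seam `interfaceDominance_of_swapWide30_firm`, cone
`rdef_of_ceg_shape_firmDescent_record`.  No `sorry`, no new axioms, no instances, no notation.
-/

namespace Summit.AtomisticToContinuum.Crystallization.Theorems.OverbindingBudgetAffineFirmDescent

open scoped BigOperators Classical
open Literature.MathematicalPhysics.StatisticalMechanics
open Literature.Geometry.DiscreteGeometry (IsChargeFree nearestDist nearestDist_nonneg nearestDist_le_dist fccTwoShellPattern hcpTwoShellPattern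
  bondGraph)
open Summit.AtomisticToContinuum.Crystallization.Theorems.OverbindingBudgetMisfitCensusStatements (Bad Short Long)
open Summit.AtomisticToContinuum.Crystallization.Theorems.OverbindingBudgetMisfitRegistration (Framed Reg DeepReg regScaleCount)
open Summit.AtomisticToContinuum.Crystallization.Theorems.OverbindingBudgetMisfitWindowStatements (InWindow offCount)
open Summit.AtomisticToContinuum.Crystallization.Theorems.OverbindingBudgetBalancedCensusStatements
open Summit.AtomisticToContinuum.Crystallization.Theorems.OverbindingBudgetAffineLadder
open Summit.AtomisticToContinuum.Crystallization.Theorems.OverbindingBudgetAffineMesoCut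
open Summit.AtomisticToContinuum.Crystallization.Theorems.OverbindingBudgetAffinePhaseCut
open Summit.AtomisticToContinuum.Crystallization.Theorems.OverbindingBudgetAffineCushionCut
open Summit.AtomisticToContinuum.Crystallization.Theorems.OverbindingBudgetAffineTwinCut
open Summit.AtomisticToContinuum.Crystallization.Theorems.OverbindingBudgetAffineRunCut
open Summit.AtomisticToContinuum.Crystallization.Theorems.OverbindingBudgetAffineCompressedCut
open Summit.AtomisticToContinuum.Crystallization.Theorems.OverbindingBudgetAffineRunCutFlat
open Summit.AtomisticToContinuum.Crystallization.Theorems.OverbindingBudgetAffineWildCut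
open Summit.AtomisticToContinuum.Crystallization.Theorems.OverbindingBudgetAffineCoreDescent
open Summit.AtomisticToContinuum.Crystallization.Theorems.OverbindingBudgetAffineStrainBand
open Summit.AtomisticToContinuum.Crystallization.Theorems.OverbindingBudgetAffineCalmDescent
open Summit.AtomisticToContinuum.Crystallization.Theorems.OverbindingBudgetAffineStableDescent

variable {N : ℕ}

/-! ## §1  Vocabulary: firm (finite-amplitude) local stability -/

/-- `FirmStable δ κ Ls y i`: no move `d` supported on IN-WINDOW sites of the `Ls·nn`-ball of `i`, with every displacement `‖d k‖ ≤ Ls·nn_i`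
(any amplitude up to the ball radius) and with the moved configuration `y + d` INJECTIVE, lowers `interactionEnergy lennardJones` by more
than `κ`.  ((429) `LocStable` is the case `‖d k‖ ≤ δ/4`, where injectivity is automatic: `locStable_of_firmStable`.) -/
def FirmStable (δ κ Ls : ℝ) (y : Fin N → EuclideanSpace ℝ (Fin 3)) (i : Fin N) : Prop :=
  ∀ d : Fin N → EuclideanSpace ℝ (Fin 3),
    (∀ k : Fin N, d k ≠ 0 → dist (y k) (y i) ≤ Ls * nearestDist y i ∧ InWindow δ 2 y k) →
    (∀ k : Fin N, ‖d k‖ ≤ Ls * nearestDist y i) →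
    Function.Injective (y + d) →
    interactionEnergy lennardJones y ≤ interactionEnergy lennardJones (y + d) + κ

/-- `FirmUnstable δ κ Ls y j`: `j` is in the window, `64`-deep registered, and NOT `(δ, κ, Ls)`-firmly stable. -/
def FirmUnstable (δ κ Ls : ℝ) (y : Fin N → EuclideanSpace ℝ (Fin 3)) (j : Fin N) : Prop :=
  InWindow δ 2 y j ∧ DeepReg 64 (3 / 50) (1 / 450) y j ∧ ¬ FirmStable δ κ Ls y j

/-- `#FirmUnstable δ κ Ls`. -/
noncomputable def firmUnstableCount (δ κ Ls : ℝ) (y : Fin N → EuclideanSpace ℝ (Fin 3)) : ℕ :=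
  Nat.card {j // FirmUnstable δ κ Ls y j}

/-- The firm guard: tight-`t` AND `(δ, κ, Ls)`-firmly stable. -/
def FirmGuard (t δ κ Ls : ℝ) : ∀ {N : ℕ}, (Fin N → EuclideanSpace ℝ (Fin 3)) → Fin N → Prop :=
  fun y j => nearestDist y j ≤ t ∧ FirmStable δ κ Ls y j

/-! ## §2  The pieces -/

/-- **`FirmGain`** [route statement · this node · kind: crux-candidate · second-order currency at finite amplitude · TRUE-type · ATTACKABLE-M —
memo §3: as `SoftGain` ((429) memo §3) with the family separation enlarged to `D ≥ 8Ls + δ + 2 + tail(κ, Ls, δ)`: the destabilising moves of a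
maximal `D`-separated family of firm-unstable sites are applied simultaneously; moved sites stay within `2Ls·nn ≤ 4Ls` of their centre, distinct
members' moved clouds stay `≥ 2` apart, so the union move is injective and the cross terms are `r⁻⁸`-summable; `floor_le` at the moved injective
configuration; packing; `C = 0` · census-type `CensusW` exactly as `SoftGain` · kernel-STRONGER than `SoftGain` (`softGain_of_firmGain`) · why it
might fail: only if the simultaneous large moves of far-apart members interacted non-summably (they do not: supports are `D − 8Ls ≥ 2`-separated
in-window matter)]: at every window, every `κ > 0`, `Ls ≥ 0`, the in-window `64`-deep `(δ, κ, Ls)`-firm-unstable sites pay. -/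
def FirmGain : Prop :=
  ∀ δ : ℝ, 0 < δ → δ ≤ 2 → ∀ κ Ls : ℝ, 0 < κ → 0 ≤ Ls →
    CensusW (fun y => firmUnstableCount δ κ Ls y) (fun y => notDeepCount 64 (3 / 50) (1 / 450) y) δ 2

/-- **`FirmRigidity t`** [route statement · this node · kind: crux · ENERGY-FREE · «registered Liouville for FIRM local minimisers» · UNDECIDED ·
kernel-WEAKER than `StableRigidity t` (`firmRigidity_of_stableRigidity`) · why it might fail: a `(3/50)`-registered, tight-`t`, force-balanced
entire Lennard-Jones configuration, stable under EVERY compactly supported injective rearrangement up to energy `κ`, that is not a strained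
internally relaxed stacking on `12·nn`-balls — the finite-amplitude competitors (cavitation, loop nucleation, affine replacement) dispose of the
one-homogeneous cones and of homogeneous tension/shear beyond the nucleation thresholds, NOT of short-wavelength registered modulations]: for every
window and precision `η₂ > 0` there are `τ, κ > 0`, `Ls, L ≥ 0` such that every calm site whose `L`-ball is tight-`t` and `(δ, κ, Ls)`-firmly
stable is `η₂`-homogeneous on its `12·nn`-ball. -/
def FirmRigidity (t : ℝ) : Prop :=
  ∀ δ : ℝ, 0 < δ → δ ≤ 2 → ∀ η₂ : ℝ, 0 < η₂ → ∃ τ κ Ls L : ℝ, 0 < τ ∧ 0 < κ ∧ 0 ≤ Ls ∧ 0 ≤ L ∧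
    ∀ (N : ℕ) (y : Fin N → EuclideanSpace ℝ (Fin 3)), Function.Injective y →
      ∀ i : Fin N, CalmG (FirmGuard t δ κ Ls) δ τ L y i → OptDeepReg 12 η₂ (1 / 10) (1 / 450) y i

/-! ## §3  Elementary relations and the kernel-certified comparisons -/

/-- Quarter-window moves of in-window sites keep injectivity: `y` injective, `d` supported on sites in the window `[δ, 2]` (`δ > 0`),
`‖d k‖ ≤ δ/4` ⇒ `y + d` injective. [this node] -/
theorem injective_add_of_quarter_moves {δ : ℝ} (hδ : 0 < δ) {y d : Fin N → EuclideanSpace ℝ (Fin 3)} (hy : Function.Injective y)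
    (hsupp : ∀ k : Fin N, d k ≠ 0 → InWindow δ 2 y k) (hsmall : ∀ k : Fin N, ‖d k‖ ≤ δ / 4) : Function.Injective (y + d) := by
  intro k l hkl
  by_contra hne
  have hkl' : y k + d k = y l + d l := by simpa [Pi.add_apply] using hkl
  have hd : d k ≠ 0 ∨ d l ≠ 0 := by
    by_contra h
    have hk0 : d k = 0 := by by_contra h'; exact h (Or.inl h')
    have hl0 : d l = 0 := by by_contra h'; exact h (Or.inr h')
    apply hne
    apply hy
    simpa [hk0, hl0] using hkl'
  have hsub : y k - y l = d l - d k := by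
    rw [sub_eq_sub_iff_add_eq_add]
    exact hkl'.trans (add_comm _ _)
  have hdist : dist (y k) (y l) ≤ δ / 2 := by
    rw [dist_eq_norm, hsub]
    calc ‖d l - d k‖ ≤ ‖d l‖ + ‖d k‖ := norm_sub_le _ _
      _ ≤ δ / 4 + δ / 4 := add_le_add (hsmall l) (hsmall k)
      _ = δ / 2 := by ring
  rcases hd with hk | hl
  · have h1 : δ ≤ nearestDist y k := (hsupp k hk).1
    have h2 : nearestDist y k ≤ dist (y k) (y l) := nearestDist_le_dist y (fun h => hne h.symm)
    linarith
  · have h1 : δ ≤ nearestDist y l := (hsupp l hl).1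
    have h2 : nearestDist y l ≤ dist (y l) (y k) := nearestDist_le_dist y hne
    rw [dist_comm] at h2
    linarith

/-- `LocStable` is antitone in the support radius `Ls`. [this node] -/
theorem locStable_anti {δ κ Ls Ls' : ℝ} (hL : Ls ≤ Ls') {y : Fin N → EuclideanSpace ℝ (Fin 3)} {i : Fin N} (h : LocStable δ κ Ls' y i) :
    LocStable δ κ Ls y i :=
  fun d hsupp hsmall =>
    h d (fun k hk => ⟨(hsupp k hk).1.trans (mul_le_mul_of_nonneg_right hL (nearestDist_nonneg y i)), (hsupp k hk).2⟩) hsmall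

/-- **Firm stability implies local stability** at an in-window site of an injective configuration, once `Ls ≥ 1/4` (then `δ/4 ≤ Ls·nn_i`, and the
quarter-window moves are injective rearrangements). [this node] -/
theorem locStable_of_firmStable {δ κ Ls : ℝ} (hδ : 0 < δ) (hLs : 1 / 4 ≤ Ls) {y : Fin N → EuclideanSpace ℝ (Fin 3)} {i : Fin N}
    (hy : Function.Injective y) (hwi : InWindow δ 2 y i) (h : FirmStable δ κ Ls y i) : LocStable δ κ Ls y i := by
  intro d hsupp hsmall
  have hamp : δ / 4 ≤ Ls * nearestDist y i := by
    have h1 : δ ≤ nearestDist y i := hwi.1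
    have h2 := mul_le_mul_of_nonneg_right hLs (nearestDist_nonneg y i)
    linarith
  exact h d hsupp (fun k => (hsmall k).trans hamp) (injective_add_of_quarter_moves hδ hy (fun k hk => (hsupp k hk).2) hsmall)

/-- **`StableRigidity t ⇒ FirmRigidity t`** (`Ls ↦ max Ls (1/4)`: on a calm ball every site is in-window, so the firm guard at `max Ls (1/4)` implies
the stable guard at `Ls`).  The firm rigidity piece is KERNEL-WEAKER than (429)'s crux. [this node] -/
theorem firmRigidity_of_stableRigidity {t : ℝ} (h : StableRigidity t) : FirmRigidity t := by
  intro δ hδ hδ2 η₂ hη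
  obtain ⟨τ, κ, Ls, L, hτ, hκ, hLs, hL, hr⟩ := h δ hδ hδ2 η₂ hη
  refine ⟨τ, κ, max Ls (1 / 4), L, hτ, hκ, hLs.trans (le_max_left _ _), hL, fun N y hy i hc => hr N y hy i ⟨hc.1, fun i' hi' => ?_⟩⟩
  have hg := hc.2 i' hi'
  have hwi' : InWindow δ 2 y i' := (hc.1.2 i' hi').1
  exact ⟨hg.1, locStable_anti (le_max_left _ _) (locStable_of_firmStable hδ (le_max_right _ _) hy hwi' hg.2)⟩

/-- `FirmRigidity` is ANTITONE in the tightness literal. [this node] -/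
theorem firmRigidity_anti {t t' : ℝ} (htt : t ≤ t') (h : FirmRigidity t') : FirmRigidity t := by
  intro δ hδ hδ2 η₂ hη
  obtain ⟨τ, κ, Ls, L, hτ, hκ, hLs, hL, hr⟩ := h δ hδ hδ2 η₂ hη
  refine ⟨τ, κ, Ls, L, hτ, hκ, hLs, hL, fun N y hy i hc => hr N y hy i ⟨hc.1, ?_⟩⟩
  exact ballGuard_mono (G := FirmGuard t δ κ Ls) (G' := FirmGuard t' δ κ Ls) (fun y j hj => ⟨hj.1.trans htt, hj.2⟩) hc.2

/-- Census monotonicity with the count comparison asked only of INJECTIVE configurations (the census quantifies over those). [this node] -/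
theorem censusW_mono_inj {A R D : ∀ {N : ℕ}, (Fin N → EuclideanSpace ℝ (Fin 3)) → ℕ} {σ₁ σ₂ : ℝ}
    (hRA : ∀ {N : ℕ} (y : Fin N → EuclideanSpace ℝ (Fin 3)), Function.Injective y → R y ≤ A y) (h : CensusW A D σ₁ σ₂) :
    CensusW R D σ₁ σ₂ := by
  obtain ⟨c, C, hc, h⟩ := h
  refine ⟨c, max C 0, hc, fun N y hy => ?_⟩
  obtain ⟨u, hu, e⟩ := h N y hy
  refine ⟨u, hu, ?_⟩
  have hR : (R y : ℝ) ≤ A y := by exact_mod_cast hRA y hy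
  exact balancedW_mono_core e hc.le hR le_rfl (Nat.cast_nonneg _) (Nat.cast_nonneg _) (Real.rpow_nonneg (Nat.cast_nonneg _) _)
    (add_nonneg (dilGain_nonneg y) (shGain_nonneg _ y))

/-- On an injective configuration, locally unstable sites are firm-unstable (`Ls ≥ 1/4`). [this node] -/
theorem locUnstableCount_le_firmUnstableCount {δ κ Ls : ℝ} (hδ : 0 < δ) (hLs : 1 / 4 ≤ Ls) {y : Fin N → EuclideanSpace ℝ (Fin 3)}
    (hy : Function.Injective y) : locUnstableCount δ κ Ls y ≤ firmUnstableCount δ κ Ls y := by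
  unfold locUnstableCount firmUnstableCount
  exact natCard_le_of_imp fun j hj => ⟨hj.1, hj.2.1, fun hf => hj.2.2 (locStable_of_firmStable hδ hLs hy hj.1 hf)⟩

/-- **`FirmGain ⇒ SoftGain`**: the firm payer is KERNEL-STRONGER than (429)'s `SoftGain` (`Ls ↦ max Ls (1/4)`). [this node] -/
theorem softGain_of_firmGain (h : FirmGain) : SoftGain := by
  intro δ hδ hδ2 κ Ls hκ hLs
  refine censusW_mono_inj (fun y hy => ?_) (h δ hδ hδ2 κ (max Ls (1 / 4)) hκ (hLs.trans (le_max_left _ _)))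
  calc locUnstableCount δ κ Ls y ≤ locUnstableCount δ κ (max Ls (1 / 4)) y := by
        unfold locUnstableCount
        exact natCard_le_of_imp fun j hj => ⟨hj.1, hj.2.1, fun hs => hj.2.2 (locStable_anti (le_max_left _ _) hs)⟩
    _ ≤ firmUnstableCount δ κ (max Ls (1 / 4)) y := locUnstableCount_le_firmUnstableCount hδ (le_max_right _ _) hy

/-- The guard-bad sites of the firm guard are dilated past `t` or firm-unstable. [this node] -/
theorem guardBadCount_firm_le (t δ κ Ls : ℝ) (y : Fin N → EuclideanSpace ℝ (Fin 3)) :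
    guardBadCount (FirmGuard t δ κ Ls) δ y ≤ dilatedTCount δ t y + firmUnstableCount δ κ Ls y := by
  unfold guardBadCount dilatedTCount firmUnstableCount
  exact natCard_le_add_of_imp fun j hj => by
    by_cases hn : nearestDist y j ≤ t
    · exact Or.inr ⟨hj.1, hj.2.1, fun hs => hj.2.2 ⟨hn, hs⟩⟩
    · exact Or.inl ⟨hj.2.1, hj.1, not_le.1 hn⟩

/-! ## §4  Glue: `CoarseMid` from the firm pieces; the record seam and cone with `StableRigidity` ABSENT -/

/-- **`CoarseMid ⟸ AgitGain ∧ DilatedDeepT t ∧ FirmGain ∧ FirmRigidity t ∧ LooseCalm ∧ OpticCalm`** (`t ≤ 21/20`).  Per window: `η₂ := min ηL ηO`,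
firm-guard dials `(τ₀, κ, Ls, L₀)` from `FirmRigidity t` at `η₂`; the guard-bad sites are dilated past `t` (paid by `DilatedDeepT t`) or
firm-unstable (paid by `FirmGain` at `(κ, Ls)`); then (430)'s generic-guard glue `affMidGapW_of_guard`. [this node] -/
theorem coarseMid_of_firm_pieces {t : ℝ} (ht : t ≤ 21 / 20) (hAg : AgitGain) (hDi : DilatedDeepT t) (hFi : FirmGain)
    (hR : FirmRigidity t) (hLo : LooseCalm) (hOp : OpticCalm) : CoarseMid := by
  intro δ hδ hδ2
  obtain ⟨ηL, τL, LL, hηL, hτL, hbandL⟩ := hLo δ hδ hδ2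
  obtain ⟨ηO, τO, LO, hηO, hτO, hbandO⟩ := hOp δ hδ hδ2
  obtain ⟨τ₀, κ, Ls, L₀, hτ₀, hκ, hLs, hL₀, hrig⟩ := hR δ hδ hδ2 (min ηL ηO) (lt_min hηL hηO)
  have hGb : CensusW (fun y => guardBadCount (FirmGuard t δ κ Ls) δ y) (fun y => notDeepCount 64 (3 / 50) (1 / 450) y) δ 2 :=
    censusW_mono (fun y => guardBadCount_firm_le t δ κ Ls y) (fun _ => le_rfl) (censusW_add (hDi δ hδ hδ2) (hFi δ hδ hδ2 κ Ls hκ hLs))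
  have hDi' : CensusW (fun y => dilatedCount δ y) (fun y => notDeepCount 64 (3 / 50) (1 / 450) y) δ 2 :=
    censusW_mono (fun y => dilatedCount_le_dilatedTCount ht δ y) (fun _ => le_rfl) (hDi δ hδ hδ2)
  exact affMidGapW_of_guard hδ hδ2 hτ₀ hL₀ hτL hτO (min_le_left _ _) (min_le_right _ _) hrig hbandL hbandO
    (fun τ hτ => hAg δ hδ hδ2 τ hτ) hDi' hGb

/-- **RECORD INSTANCE `t = 1`: `CoarseMid ⟸ AgitGain ∧ DilatedDeepT 1 ∧ FirmGain ∧ FirmRigidity 1 ∧ LooseCalm ∧ OpticCalm`.** [this node] -/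
theorem coarseMid_of_firm_pieces_one (hAg : AgitGain) (hDi : DilatedDeepT 1) (hFi : FirmGain) (hR : FirmRigidity 1) (hLo : LooseCalm)
    (hOp : OpticCalm) : CoarseMid :=
  coarseMid_of_firm_pieces (by norm_num) hAg hDi hFi hR hLo hOp

/-- Consistency: the (429)/(430) stable leaf set implies the firm leaf set's glue hypotheses (so this node never asks MORE than the record). [this node] -/
theorem coarseMid_of_firm_pieces_of_stable (hAg : AgitGain) (hDi : DilatedDeepT 1) (hFi : FirmGain) (hR : StableRigidity 1) (hLo : LooseCalm)
    (hOp : OpticCalm) : CoarseMid :=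
  coarseMid_of_firm_pieces_one hAg hDi hFi (firmRigidity_of_stableRigidity hR) hLo hOp

/-- **THE RECORD SEAM through the firm descent:
`InterfaceDominance ⟸ SW♭₃₀ ∧ MildBand ∧ StrongBand ∧ (AgitGain ∧ DilatedDeepT 1 ∧ FirmGain ∧ FirmRigidity 1 ∧ LooseCalm ∧ OpticCalm) ∧ ThinFault`.** [this node] -/
theorem interfaceDominance_of_swapWide30_firm (hT : StackSwapGainFlatWide30) (hMi : MildBand) (hSt : StrongBand)
    (hAg : AgitGain) (hDi : DilatedDeepT 1) (hFi : FirmGain) (hR : FirmRigidity 1) (hLo : LooseCalm) (hOp : OpticCalm) (hF : ThinFault) :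
    InterfaceDominance :=
  interfaceDominance_of_swapWide30_bands hT hMi hSt (coarseMid_of_firm_pieces_one hAg hDi hFi hR hLo hOp) hF

/-- **RDEF of record through the firm descent** (tree cone `rdef_of_ceg_shape_strainBand_record` BY NAME, its `CoarseMid` leaf discharged from the six
firm pieces at `t = 1`; neither `CalmRigidity` nor `StableRigidity` occurs). [this node] -/
theorem rdef_of_ceg_shape_firmDescent_record
    (hCEG : Summit.AtomisticToContinuum.Crystallization.Theses.PricedLinkCensus.ChargedEnergyGap)
    (hSh : OverbindingBudgetTwoShellShape.TwoShellShape (1 / 100) (3 / 50) (1 / 450))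
    (hQH : TameBalancedHexRoughGap 64 12 (1 / 10 ^ 5) (1 / 25) (3 / 50) (1 / 450) 12) (hQ : RoughCubic)
    (hT : StackSwapGainFlatWide30) (hMi : MildBand) (hSt : StrongBand)
    (hAg : AgitGain) (hDi : DilatedDeepT 1) (hFi : FirmGain) (hR : FirmRigidity 1) (hLo : LooseCalm) (hOp : OpticCalm) (hF : ThinFault)
    (hK : ∃ μ₁ μR : ℝ, 0 < μ₁ ∧ 0 < μR ∧ OverbindingBudgetAffineNearCluster.PureMarginStabilityAt (3 / 2000) μ₁ μR 4)
    (hA : AffineChartStraightening)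
    (hE : OverbindingBudgetAffineNearCluster.NearLightSkeletonEquilibrium (3 / 2000) 4 6 (1 / 1000) 12 (1 / 25) (1 / 2000) 4 6 320 12)
    (hCF : OverbindingBudgetAffineNearCluster.NearPricedCoreFloor (3 / 2000) 4 6 (1 / 1000) 12 (1 / 25) (1 / 2000) (1 / (4 * 10 ^ 7) / 4) 4 6 12)
    (hSF : OverbindingBudgetAffineNearCluster.NearPricedShellFloor (3 / 2000) 4 6 (1 / 1000) 12 (1 / 25) (1 / 2000) (1 / (4 * 10 ^ 7) / 4) 4 6 12)
    (hV : OverbindingBudgetAffineNearCluster.ForceContentVisible (3 / 2000) 4 6 (1 / 1000) 12 (1 / 25) (1 / 2000) 4 6)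
    (hN : OverbindingBudgetAffineNearCluster.NearSecondOrderFloor (3 / 2000) 4 6 (1 / 1000) 12 (1 / 25) (1 / 2000) (1 / (4 * 10 ^ 7)))
    (hFA : OverbindingBudgetAffineLocalisation.FarAggregatePricing 12 (1 / 25) (1 / 2000) (1 / (2 * 10 ^ 7)))
    (hFR : FineNonAffinity 12 (1 / 10 ^ 5) (1 / 25))
    (hTT : OverbindingBudgetGradedBareness.CleanlessExcessT) (hRR : OverbindingBudgetCoherentCut.CoherentResidual 10) :
    Summit.AtomisticToContinuum.Crystallization.Theses.OverbindingBudget.RobustDefectLimitWindows :=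
  rdef_of_ceg_shape_strainBand_record hCEG hSh hQH hQ hT hMi hSt (coarseMid_of_firm_pieces_one hAg hDi hFi hR hLo hOp) hF hK hA hE hCF hSF hV
    hN hFA hFR hTT hRR

end Summit.AtomisticToContinuum.Crystallization.Theorems.OverbindingBudgetAffineFirmDescent
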